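import Literature.NumberTheory.Sieve.SmoothZetaComplex
import Literature.NumberTheory.Sieve.SmoothSaddlePointPhi
import HarnessLib

/-!
# Decay of `ζ(σ + it, y)` near the real axis, uniformly in `σ > 0` (Hildebrand–Tenenbaum, Lemma 8 (i))

Topic `Literature/NumberTheory/Sieve`; a PROVED tool toward Hildebrand–Tenenbaum's saddle-point theorem
[HildebrandTenenbaum1986, Thm 1]. The tree's `norm_smoothZetaC_le_mul_exp_gaussian` gives the Gaussian
decay `|ζ(σ+it, y)| ≤ ζ(σ, y) exp(-(2/(25π²)) t² φ₂(σ, y))` for `|t| log y ≤ π` but only for `σ ≥ 3/5`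
(it bounds the weights `w_p ≤ 24`); Theorem 1 over the whole range `x ≥ y ≥ 2` needs `σ = α(x, y)`
arbitrary in `(0, 1]`. Here, from the exact identity `|1 - p^{-s}|²/(1 - p^{-σ})² = 1 + w_p`,
`w_p = 2p^σ(1 - cos(t log p))/(p^σ - 1)²` [op. cit. (3.17)] and `1 - cos θ ≥ (2/π²)θ²` (`|θ| ≤ π`):

* `norm_smoothZetaC_le_mul_exp_neg_sum_min` — for ALL `σ > 0` and `|t| log y ≤ π`:
  `|ζ(σ+it, y)| ≤ ζ(σ, y) · exp(-(1/4) Σ_{p ≤ y} min(1, v_p))`,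
  `v_p = (4/π²) t² · log² p · p^σ/(p^σ - 1)²` (the `p`-term of `(4/π²) t² φ₂(σ, y)`), via
  `log(1 + v) ≥ ½ min(1, v)`;
* `norm_smoothZetaC_le_mul_exp_gaussian_of_le` — if moreover every `v_p ≤ V` (`V ≥ 1`), the Gaussian form
  `|ζ(σ+it, y)| ≤ ζ(σ, y) exp(-t² φ₂(σ, y)/(π² V))`;
* `norm_smoothZetaC_le_mul_exp_card_of_le` — if every `v_p ≥ 1`, then `|ζ(σ+it, y)| ≤ ζ(σ, y) e^{-π(y)/4}`.

At `σ = α(x, y)` with `α log y ≤ 1` one has `p^α/(p^α-1)² ∈ [1/(9α² log² p), 3/(α² log² p)]`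
(`rpow_sub_one_bounds`), so `v_p ≤ 12 t²/(π²α²) ≤ 2` for `|t| ≤ α` (Gaussian regime, `V = 2`) and
`v_p ≥ 4t²/(9π²α²) ≥ 1` for `|t| ≥ 5α` (the `e^{-π(y)/4}` regime) — Hildebrand–Tenenbaum's (3.15) in the
range `y ≤ log x`; for `α log y > 1` the weights are bounded (`V = 80` off the `≤ y^{1/4} + 1` primes with
`p^α < 5/4`). These saddle-point corollaries are left to the assembly of Lemma 11.

## References

* [HildebrandTenenbaum1986] A. Hildebrand, G. Tenenbaum, Trans. AMS 296 (1986) 265–290, Lemma 8 (i)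
  (3.15) and its proof, (3.17) (held: `paper:doi-10-1090-s0002-9947-1986-0837811-1`, pp. 275–277).
-/

noncomputable section

open Complex Finset Real

namespace Literature.NumberTheory.Sieve

variable {σ t : ℝ} {y p : ℕ}

/-- `log(1 + v) ≥ ½ min(1, v)` for `v ≥ 0` (`log(1+v) ≥ v/(1+v) ≥ v/2` on `[0, 1]`, and `log 2 ≥ 1/2`).
[folklore] -/
theorem half_min_le_log_one_add {v : ℝ} (hv : 0 ≤ v) : 1 / 2 * min 1 v ≤ Real.log (1 + v) := by
  have h1 : 0 < 1 + v := by linarith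
  -- `log(1+v) ≥ v/(1+v)`
  have hlog : v / (1 + v) ≤ Real.log (1 + v) := by
    have h := Real.log_le_sub_one_of_pos (inv_pos.2 h1)
    rw [Real.log_inv] at h
    have : (1 + v)⁻¹ - 1 = -(v / (1 + v)) := by field_simp; ring
    linarith
  rcases le_or_gt v 1 with hv1 | hv1
  · rw [min_eq_right hv1]
    calc 1 / 2 * v ≤ v / (1 + v) := by
          rw [le_div_iff₀ h1]; nlinarith
      _ ≤ Real.log (1 + v) := hlog
  · rw [min_eq_left hv1.le]
    calc (1 / 2 : ℝ) * 1 ≤ v / (1 + v) := by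
          rw [le_div_iff₀ h1]; nlinarith
      _ ≤ Real.log (1 + v) := hlog

/-- **The Euler factor, per prime, uniformly in `σ > 0`**: for a prime `p` with `|t| log p ≤ π`,
`‖1 - p^{-(σ+it)}‖⁻¹ ≤ (1 - p^{-σ})⁻¹ exp(-¼ min(1, v_p))`, `v_p = (4/π²) t² log² p · p^σ/(p^σ - 1)²`
(`‖1 - p^{-s}‖² = (1 - p^{-σ})²(1 + w_p)` with `w_p ≥ v_p`, and `1 + v ≥ exp(½ min(1, v))`).
[cite: HildebrandTenenbaum1986, Lemma 8, proof of (3.15), (3.17)] -/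
theorem inv_norm_one_sub_cpow_le_exp_min (hp : 2 ≤ p) (hσ : 0 < σ) (ht : |t| * Real.log p ≤ Real.pi) :
    ‖1 - (p : ℂ) ^ (-((σ : ℂ) + t * I))‖⁻¹ ≤ (1 - (p : ℝ) ^ (-σ))⁻¹ *
      Real.exp (-(1 / 4) * min 1 (4 / Real.pi ^ 2 * t ^ 2 *
        (Real.log p ^ 2 * ((p : ℝ) ^ σ / ((p : ℝ) ^ σ - 1) ^ 2)))) := by
  have hp0 : 0 < p := by omega
  have hp1r : (1 : ℝ) < p := by exact_mod_cast lt_of_lt_of_le one_lt_two hp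
  have hp0r : (0 : ℝ) < p := by linarith
  have hlogp0 : 0 ≤ Real.log p := Real.log_nonneg hp1r.le
  set a : ℝ := (p : ℝ) ^ (-σ) with ha
  set c : ℝ := 1 - Real.cos (t * Real.log p) with hc
  have hP1 : 1 < (p : ℝ) ^ σ := Real.one_lt_rpow hp1r hσ
  have hinv : a = ((p : ℝ) ^ σ)⁻¹ := by rw [ha]; exact Real.rpow_neg hp0r.le σ
  have ha0 : 0 < a := by rw [ha]; exact Real.rpow_pos_of_pos hp0r _
  have ha1 : a < 1 := by rw [hinv]; exact inv_lt_one_of_one_lt₀ hP1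
  have h1a : 0 < 1 - a := by linarith
  have hc0 : 0 ≤ c := by rw [hc]; linarith [Real.cos_le_one (t * Real.log p)]
  -- the weight `w` and the Gaussian weight `v ≤ w`
  set w : ℝ := 2 * a * c / (1 - a) ^ 2 with hw
  set g : ℝ := Real.log p ^ 2 * ((p : ℝ) ^ σ / ((p : ℝ) ^ σ - 1) ^ 2) with hg
  set v : ℝ := 4 / Real.pi ^ 2 * t ^ 2 * g with hv
  have hratio : a / (1 - a) ^ 2 = (p : ℝ) ^ σ / ((p : ℝ) ^ σ - 1) ^ 2 := by
    rw [hinv]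
    have hP0 : (p : ℝ) ^ σ ≠ 0 := by positivity
    have hP1' : (p : ℝ) ^ σ - 1 ≠ 0 := by linarith
    field_simp
  have hden : 0 < (p : ℝ) ^ σ - 1 := by linarith
  have hg0 : 0 ≤ g := by rw [hg]; positivity
  have hv0 : 0 ≤ v := by rw [hv]; positivity
  have hφ : |t * Real.log p| ≤ Real.pi := by rwa [abs_mul, abs_of_nonneg hlogp0]
  have hcos := two_div_pi_sq_mul_sq_le_one_sub_cos hφ
  have hvw : v ≤ w := by
    rw [hv, hw, hg, ← hratio]
    calc 4 / Real.pi ^ 2 * t ^ 2 * (Real.log p ^ 2 * (a / (1 - a) ^ 2))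
        = (2 / Real.pi ^ 2 * (t * Real.log p) ^ 2) * (2 * a / (1 - a) ^ 2) := by ring
      _ ≤ c * (2 * a / (1 - a) ^ 2) := mul_le_mul_of_nonneg_right (by rw [hc]; exact hcos) (by positivity)
      _ = 2 * a * c / (1 - a) ^ 2 := by ring
  have hnorm_sq : ‖1 - (p : ℂ) ^ (-((σ : ℂ) + t * I))‖ ^ 2 = (1 - a) ^ 2 * (1 + w) := by
    rw [norm_sq_one_sub_cpow_eq_mul hp hσ t]
  -- `1 + v ≥ exp(½ min(1, v))`
  have hexp : Real.exp (1 / 2 * min 1 v) ≤ 1 + v := by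
    calc Real.exp (1 / 2 * min 1 v) ≤ Real.exp (Real.log (1 + v)) :=
          Real.exp_le_exp.2 (half_min_le_log_one_add hv0)
      _ = 1 + v := Real.exp_log (by linarith)
  have hkey : (1 + w)⁻¹ ≤ Real.exp (2 * (-(1 / 4) * min 1 v)) := by
    have h1v : 0 < 1 + v := by linarith
    calc (1 + w)⁻¹ ≤ (1 + v)⁻¹ := inv_anti₀ h1v (by linarith)
      _ ≤ (Real.exp (1 / 2 * min 1 v))⁻¹ := inv_anti₀ (Real.exp_pos _) hexp
      _ = Real.exp (2 * (-(1 / 4) * min 1 v)) := by rw [← Real.exp_neg]; ring_nf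
  have hpos : 0 < ‖1 - (p : ℂ) ^ (-((σ : ℂ) + t * I))‖ := by
    have hsre : 0 < ((σ : ℂ) + t * I).re := by simp [hσ]
    exact norm_pos_iff.2 (one_sub_cpow_ne_zero hp hsre)
  have hgoal_sq : ‖1 - (p : ℂ) ^ (-((σ : ℂ) + t * I))‖⁻¹ ^ 2 ≤
      ((1 - a)⁻¹ * Real.exp (-(1 / 4) * min 1 v)) ^ 2 := by
    have hw0 : 0 ≤ w := by rw [hw]; positivity
    calc ‖1 - (p : ℂ) ^ (-((σ : ℂ) + t * I))‖⁻¹ ^ 2 = ((1 - a) ^ 2)⁻¹ * (1 + w)⁻¹ := by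
          rw [inv_pow, hnorm_sq, mul_inv]
      _ ≤ ((1 - a) ^ 2)⁻¹ * Real.exp (2 * (-(1 / 4) * min 1 v)) :=
          mul_le_mul_of_nonneg_left hkey (by positivity)
      _ = ((1 - a)⁻¹ * Real.exp (-(1 / 4) * min 1 v)) ^ 2 := by
          rw [mul_pow, inv_pow, ← Real.exp_nat_mul]
          push_cast
          ring_nf
  exact (pow_le_pow_iff_left₀ (by positivity) (by positivity) two_ne_zero).1 hgoal_sq

/-- **Decay of `ζ(s, y)` near the real axis, uniformly in `σ > 0`**: for `|t| log y ≤ π`,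
`|ζ(σ+it, y)| ≤ ζ(σ, y) · exp(-¼ Σ_{p ≤ y} min(1, (4/π²) t² log² p · p^σ/(p^σ-1)²))`.
[cite: HildebrandTenenbaum1986, Lemma 8 (i) (3.15), proof] -/
theorem norm_smoothZetaC_le_mul_exp_neg_sum_min (hσ : 0 < σ) (ht : |t| * Real.log y ≤ Real.pi) :
    ‖smoothZetaC ((σ : ℂ) + t * I) y‖ ≤ smoothZeta σ y *
      Real.exp (-(1 / 4) * ∑ p ∈ Nat.primesLE y, min 1 (4 / Real.pi ^ 2 * t ^ 2 *
        (Real.log p ^ 2 * ((p : ℝ) ^ σ / ((p : ℝ) ^ σ - 1) ^ 2)))) := by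
  have hy : ∀ p ∈ Nat.primesLE y, |t| * Real.log p ≤ Real.pi := by
    intro p hp
    obtain ⟨hpy, hpp⟩ := Nat.mem_primesLE.1 hp
    have hp0 : (0 : ℝ) < p := by exact_mod_cast hpp.pos
    exact le_trans (mul_le_mul_of_nonneg_left (Real.log_le_log hp0 (by exact_mod_cast hpy)) (abs_nonneg t)) ht
  rw [smoothZetaC, smoothZeta, norm_prod, Finset.mul_sum, Real.exp_sum, ← Finset.prod_mul_distrib]
  refine Finset.prod_le_prod (fun p _ => norm_nonneg _) fun p hp => ?_
  rw [norm_inv]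
  exact inv_norm_one_sub_cpow_le_exp_min (Nat.mem_primesLE.1 hp).2.two_le hσ (hy p hp)

/-- **Gaussian form**: if `|t| log y ≤ π` and every weight is at most `V ≥ 1`
(`(4/π²) t² log² p · p^σ/(p^σ-1)² ≤ V` for `p ≤ y`), then
`|ζ(σ+it, y)| ≤ ζ(σ, y) exp(-t² φ₂(σ, y)/(π² V))` (`min(1, v) ≥ v/V`).
[cite: HildebrandTenenbaum1986, Lemma 8 (i) (3.15)] -/
theorem norm_smoothZetaC_le_mul_exp_gaussian_of_le (hσ : 0 < σ) (ht : |t| * Real.log y ≤ Real.pi) {V : ℝ}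
    (hV : 1 ≤ V)
    (hv : ∀ p ∈ Nat.primesLE y,
      4 / Real.pi ^ 2 * t ^ 2 * (Real.log p ^ 2 * ((p : ℝ) ^ σ / ((p : ℝ) ^ σ - 1) ^ 2)) ≤ V) :
    ‖smoothZetaC ((σ : ℂ) + t * I) y‖ ≤ smoothZeta σ y *
      Real.exp (-(t ^ 2 * saddlePhi₂ σ y / (Real.pi ^ 2 * V))) := by
  refine le_trans (norm_smoothZetaC_le_mul_exp_neg_sum_min hσ ht) ?_
  refine mul_le_mul_of_nonneg_left (Real.exp_le_exp.2 ?_) (smoothZeta_pos hσ).le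
  have hV0 : 0 < V := by linarith
  -- termwise `min(1, v_p) ≥ v_p/V`
  have hsum : ∑ p ∈ Nat.primesLE y, 4 / Real.pi ^ 2 * t ^ 2 *
      (Real.log p ^ 2 * ((p : ℝ) ^ σ / ((p : ℝ) ^ σ - 1) ^ 2)) / V ≤
      ∑ p ∈ Nat.primesLE y, min 1 (4 / Real.pi ^ 2 * t ^ 2 *
        (Real.log p ^ 2 * ((p : ℝ) ^ σ / ((p : ℝ) ^ σ - 1) ^ 2))) := by
    refine Finset.sum_le_sum fun p hp => ?_
    have hp2 : (2 : ℝ) ≤ p := by exact_mod_cast (Nat.mem_primesLE.1 hp).2.two_le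
    have hP1 : 1 < (p : ℝ) ^ σ := Real.one_lt_rpow (by linarith) hσ
    have hden : 0 < (p : ℝ) ^ σ - 1 := by linarith
    set v := 4 / Real.pi ^ 2 * t ^ 2 * (Real.log p ^ 2 * ((p : ℝ) ^ σ / ((p : ℝ) ^ σ - 1) ^ 2)) with hvdef
    have hv0 : 0 ≤ v := by positivity
    rcases le_or_gt v 1 with hv1 | hv1
    · rw [min_eq_right hv1, div_le_iff₀ hV0]; nlinarith
    · rw [min_eq_left hv1.le, div_le_iff₀ hV0]; linarith [hv p hp]
  have heq : ∑ p ∈ Nat.primesLE y, 4 / Real.pi ^ 2 * t ^ 2 *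
      (Real.log p ^ 2 * ((p : ℝ) ^ σ / ((p : ℝ) ^ σ - 1) ^ 2)) / V =
      4 / Real.pi ^ 2 * t ^ 2 * saddlePhi₂ σ y / V := by
    rw [saddlePhi₂_def, Finset.mul_sum, Finset.sum_div]
  rw [heq] at hsum
  have : -(t ^ 2 * saddlePhi₂ σ y / (Real.pi ^ 2 * V)) = -(1 / 4) * (4 / Real.pi ^ 2 * t ^ 2 * saddlePhi₂ σ y / V) := by
    ring
  rw [this]
  have h4 : (0 : ℝ) < 1 / 4 := by norm_num
  nlinarith

/-- **The saturated regime**: if `|t| log y ≤ π` and every weight is at least `1`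
(`(4/π²) t² log² p · p^σ/(p^σ-1)² ≥ 1` for `p ≤ y`), then `|ζ(σ+it, y)| ≤ ζ(σ, y) e^{-π(y)/4}`.
[cite: HildebrandTenenbaum1986, Lemma 8 (i) (3.15)] -/
theorem norm_smoothZetaC_le_mul_exp_card_of_le (hσ : 0 < σ) (ht : |t| * Real.log y ≤ Real.pi)
    (hv : ∀ p ∈ Nat.primesLE y,
      1 ≤ 4 / Real.pi ^ 2 * t ^ 2 * (Real.log p ^ 2 * ((p : ℝ) ^ σ / ((p : ℝ) ^ σ - 1) ^ 2))) :
    ‖smoothZetaC ((σ : ℂ) + t * I) y‖ ≤ smoothZeta σ y *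
      Real.exp (-((#(Nat.primesLE y) : ℝ) / 4)) := by
  refine le_trans (norm_smoothZetaC_le_mul_exp_neg_sum_min hσ ht) ?_
  refine mul_le_mul_of_nonneg_left (Real.exp_le_exp.2 ?_) (smoothZeta_pos hσ).le
  have hsum : ∑ p ∈ Nat.primesLE y, min 1 (4 / Real.pi ^ 2 * t ^ 2 *
      (Real.log p ^ 2 * ((p : ℝ) ^ σ / ((p : ℝ) ^ σ - 1) ^ 2))) = (#(Nat.primesLE y) : ℝ) := by
    rw [Finset.sum_congr rfl fun p hp => min_eq_left (hv p hp), Finset.sum_const, nsmul_eq_mul, mul_one]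
  rw [hsum]
  linarith

end Literature.NumberTheory.Sieve
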